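import Summits.HubbardSuperconductivity.HubbardSuperconductivity.Theorems.FunctionFieldCertificateMesoscopicPairOrderFlatOfPgdAt
import HarnessLib

/-!
# `MesoscopicPairOrder` (stmt-HubbardSuperconductivity-7331), line `redirect_birth`, stub (Flat)
# `stub_offWindowFlatOnBox`: which flat bound gives back C⁺_λ — only a STATE-UNIFORM one

Helper for stub (Flat) `stub_offWindowFlatOnBox` (lead c11, wave 4); the stub itself (no pair-density-wave
Bragg peak off the window `|q_m| > η` in any `(N_L, 0)`-sector ground state of the doped Hubbard torus on the
box) is OPEN physics and is neither proved nor refuted here. Wave 3 (`…FlatOfPgdAt.lean`, p160921) typed the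
weakest known sufficient input: own-bottom `λ_q`-regularised energy-form pair Gaussian domination C⁺_λ at the
off-window momenta plus the charging floor (Ch) ⇒ (Flat). This file settles the converse question "does a
flat structure factor give C⁺_λ back trivially (`χ ≤ ‖Δψ‖²/λ_q`)?" — for C⁺_λ ITSELF the answer is: only from
a bound over ALL sector vectors, not from ground-state flatness.

* `pof_le_minEnergyOn_sourced` (abstract) — a sourced two-block form `A − tB` on `K₁ ⊔ K₀` (`B` Hermitian
  and off-diagonal, `A ≥ e + λ` on `K₁` with `λ > 0`, `A ≥ e` on `K₀`, `|⟨u, Bv⟩| ≤ M‖u‖‖v‖`) has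
  `minEnergyOn ≥ e − (M²/λ)t²`: complete the square `λa² − 2|t|Mab ≥ −M²t²b²/λ` (Schur complement
  against the regulariser).
* `pgdAt_of_pairAmplitudeBoundAt` — **state-uniform pair-amplitude bound ⇒ C⁺_λ at that momentum, all
  `t`, `C_χ = K/c₀`**: if EVERY `φ` of the sector `(2k, 0)` has `‖Δ(m)φ‖² ≤ KL²‖φ‖²` and
  `‖Δ(m)ᴴφ‖² ≤ KL²‖φ‖²`, both one-sided C⁺_λ inequalities (verbatim the two conjuncts of
  `WindowInfraredBound.stub_pairGaussianDomination` / of the wave-3 hypothesis, at general `N = 2k`) hold for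
  every real `t` and every `c₀ > 0`. WHY THIS DOES NOT GIVE (Flat): the hypothesis is not a ground-state
  statement. (i) A priori it holds only with `K = 32L²` (`S_φ(m) ≤ 32L²` for EVERY unit `φ`, the Parseval
  ceiling `wib_sum_pairStructureFactor_le` / `InfraredCompletion.pairStructureFactor_le_sumRule`, plus F2
  for the `Δᴴ` side), i.e. C⁺_λ with `C_χ = 32L²/c₀`, useless — (Flat) via engine C needs `C_χ`
  independent of `L` (`S(η) = A(C_χ)/η`, `offWindowFlatAt_of_offWindowPgdAt_of_chargingFloorAt`). (ii) With `K` fixed it is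
  expected to FAIL for large `L`: a Dicke pair condensate of the sector at pair momentum `q_m` has
  `‖Δ(m)φ‖² = Θ(L⁴)` (the tree's twisted-Dicke sector state
  `WindowInfraredBound.Negative.exists_sector_state_large_pairStructureFactor` is the `|q| = 4π/L` instance).
  So C⁺_λ has genuine EXCITED-STATE content (Schur form: `(‖Δφ‖ − √(c₀C_χ)L)₊² ≤ C_χL²⟨φ,(H−E)φ⟩/|q_m|²`
  for all `φ` in the sector), which ground-state flatness cannot supply; what GS-flatness does give — the
  regularised variational stiffness (T_λ∓), the only consequence of C⁺_λ engine C uses — and the resulting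
  honest equivalence (Flat) ⟺_{(Ch)} off-window (T_λ∓) are the sibling file `…FlatIffStiffnessAt.lean`.
* `offWindowPgdAt_of_offWindowPairAmplitudeBoundAt` / registered one-line form `pgdAtOfPairAmplitudeBoundAt`
  — the state-uniform bound, eventually in even `L` at the off-window labels, gives the off-window C⁺_λ
  hypothesis of `offWindowFlatAt_of_offWindowPgdAt_of_chargingFloorAt` VERBATIM (`C_χ = K`, `c₀ = 1`):
  position bookkeeping (all-states-flat ⇒ off-window C⁺_λ ⇒_{(Ch)} (Flat)), vacuous in practice by (ii).

Nothing here claims C⁺_λ, (Ch) or (Flat). No definition, no named fact, no sorry. Sources: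
Kennedy–Lieb–Shastry, PRL 61 (1988) 2582, eqs. (17)–(19); Dyson–Lieb–Simon, J. Stat. Phys. 18 (1978) 335,
Thm 4.2 (Gaussian domination as a sourced ground-energy bound); folklore finite-dimensional linear algebra.
-/

noncomputable section

-- the summit namespace repeats the problem name by design (D-0017)
set_option linter.dupNamespace false

namespace Summit.HubbardSuperconductivity.HubbardSuperconductivity.Theorems.FunctionFieldCertificate

open Matrix Finset Filter
open Literature.Probability.LatticeModels Literature.MathematicalPhysics.QuantumLattice
open Summit.HubbardSuperconductivity.HubbardSuperconductivity.Theses.FunctionFieldCertificate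
open scoped ComplexOrder ComplexConjugate

/-! ### Abstract: a sourced two-block form bounded below by completing the square -/

section Abstract

variable {n : Type*} [Fintype n]

/-- Completing the square: `λa² − 2cab ≥ −c²/λ` for `λ > 0`, `b² ≤ 1`. [folklore] -/
theorem pof_real_kernel {lam a b c : ℝ} (hlam : 0 < lam) (hb : b ^ 2 ≤ 1) :
    -(c ^ 2 / lam) ≤ lam * a ^ 2 - 2 * c * a * b := by
  have h1 : 0 ≤ (lam * a - c * b) ^ 2 / lam := by positivity
  have h2 : (lam * a - c * b) ^ 2 / lam = lam * a ^ 2 - 2 * c * a * b + c ^ 2 * b ^ 2 / lam := by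
    field_simp
    ring
  have h3 : c ^ 2 * b ^ 2 / lam ≤ c ^ 2 / lam :=
    div_le_div_of_nonneg_right (by nlinarith [sq_nonneg c]) hlam.le
  linarith [h1, h2, h3]

/-- **Sourced two-block form, bounded below by completing the square.** Let `A`, `B` be Hermitian,
`K₁`, `K₀` mutually orthogonal subspaces (`K₀ ≠ ⊥`) with `⟨K₁, A K₀⟩ = 0`, `A ≥ e + λ` on `K₁` (`λ > 0`),
`A ≥ e` on `K₀`, `B` with no diagonal matrix elements inside `K₁` or `K₀` and `|⟨u, B v⟩| ≤ M‖u‖‖v‖`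
(`u ∈ K₁`, `v ∈ K₀`). Then `minEnergyOn (A − tB) (K₁ ⊔ K₀) ≥ e − (M²/λ) t²` for every real `t`: on a unit
`w = u + v`, `Re⟨w, (A − tB) w⟩ ≥ e + λ‖u‖² − 2|t|M‖u‖‖v‖ ≥ e − M²t²/λ`. This is the variational content
of "a state-uniform pair-amplitude bound ⇒ Gaussian domination". [folklore] -/
theorem pof_le_minEnergyOn_sourced {A B : Matrix n n ℂ} (hA : A.IsHermitian) (hB : B.IsHermitian)
    (K₁ K₀ : Submodule ℂ (n → ℂ)) {e lam M : ℝ} (hlam : 0 < lam)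
    (hne : ∃ φ ∈ K₀, φ ≠ 0)
    (horth : ∀ u ∈ K₁, ∀ v ∈ K₀, star u ⬝ᵥ v = 0)
    (hAoff : ∀ u ∈ K₁, ∀ v ∈ K₀, star u ⬝ᵥ (A *ᵥ v) = 0)
    (hA₁ : ∀ u ∈ K₁, (e + lam) * (star u ⬝ᵥ u).re ≤ (star u ⬝ᵥ (A *ᵥ u)).re)
    (hA₀ : ∀ v ∈ K₀, e * (star v ⬝ᵥ v).re ≤ (star v ⬝ᵥ (A *ᵥ v)).re)
    (hB₁ : ∀ u ∈ K₁, star u ⬝ᵥ (B *ᵥ u) = 0) (hB₀ : ∀ v ∈ K₀, star v ⬝ᵥ (B *ᵥ v) = 0)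
    (hBoff : ∀ u ∈ K₁, ∀ v ∈ K₀, ‖star u ⬝ᵥ (B *ᵥ v)‖ ≤ M * (eucNorm u * eucNorm v)) (t : ℝ) :
    e - M ^ 2 / lam * t ^ 2 ≤ (A - (t : ℂ) • B).minEnergyOn (K₁ ⊔ K₀) := by
  -- the Rayleigh set is nonempty: normalise a nonzero vector of `K₀ ≤ K₁ ⊔ K₀`
  obtain ⟨φ, hφ, hφ0⟩ := hne
  obtain ⟨c, -, hc1⟩ := exists_smul_unit hφ0
  refine le_csInf ⟨_, c • φ, Submodule.mem_sup_right (K₀.smul_mem c hφ), hc1, rfl⟩ ?_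
  rintro E ⟨w, hw, hw1, rfl⟩
  obtain ⟨u, hu, v, hv, rfl⟩ := Submodule.mem_sup.1 hw
  -- vanishing and conjugate cross terms
  have horth' : star v ⬝ᵥ u = 0 := by rw [star_dotProduct, horth u hu v hv, star_zero]
  have hAoff' : star v ⬝ᵥ (A *ᵥ u) = 0 := by
    rw [WcbcsSsbToTorusLRO.mc_star_dotProduct_mulVec_eq A v u, hA.eq, star_dotProduct, hAoff u hu v hv,
      star_zero]
  have hBcross : star v ⬝ᵥ (B *ᵥ u) = star (star u ⬝ᵥ (B *ᵥ v)) := by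
    rw [WcbcsSsbToTorusLRO.mc_star_dotProduct_mulVec_eq B v u, hB.eq, star_dotProduct]
  -- norms `a = ‖u‖`, `b = ‖v‖`, `a² + b² = 1`
  have ha2 : (star u ⬝ᵥ u).re = eucNorm u ^ 2 := (eucNorm_sq u).symm
  have hb2 : (star v ⬝ᵥ v).re = eucNorm v ^ 2 := (eucNorm_sq v).symm
  have hnorm : eucNorm u ^ 2 + eucNorm v ^ 2 = 1 := by
    have h := congrArg Complex.re hw1
    rwa [star_add, add_dotProduct, dotProduct_add, dotProduct_add, horth u hu v hv, horth', add_zero,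
      zero_add, Complex.add_re, ha2, hb2, Complex.one_re] at h
  -- the Rayleigh quotient of `u + v`
  have hray : (star (u + v) ⬝ᵥ ((A - (t : ℂ) • B) *ᵥ (u + v))).re =
      (star u ⬝ᵥ (A *ᵥ u)).re + (star v ⬝ᵥ (A *ᵥ v)).re - t * (2 * (star u ⬝ᵥ (B *ᵥ v)).re) := by
    simp only [sub_mulVec, smul_mulVec, mulVec_add, star_add, add_dotProduct, dotProduct_add,
      dotProduct_sub, dotProduct_smul, smul_eq_mul, hAoff u hu v hv, hAoff', hB₁ u hu, hB₀ v hv,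
      hBcross]
    simp only [Complex.add_re, Complex.sub_re, Complex.re_ofReal_mul, Complex.star_def,
      Complex.conj_re, add_zero, zero_add]
    ring
  -- the source term: `|t · 2Re⟨u,Bv⟩| ≤ 2|t|M a b`
  have hab : 0 ≤ eucNorm u * eucNorm v := mul_nonneg (eucNorm_nonneg _) (eucNorm_nonneg _)
  have hsrc : t * (2 * (star u ⬝ᵥ (B *ᵥ v)).re) ≤ 2 * (|t| * M) * eucNorm u * eucNorm v := by
    have h2 : |(star u ⬝ᵥ (B *ᵥ v)).re| ≤ M * (eucNorm u * eucNorm v) :=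
      (Complex.abs_re_le_norm _).trans (hBoff u hu v hv)
    have h3 : |t * (2 * (star u ⬝ᵥ (B *ᵥ v)).re)| ≤ |t| * (2 * (M * (eucNorm u * eucNorm v))) := by
      rw [abs_mul, abs_mul, abs_two]
      exact mul_le_mul_of_nonneg_left (mul_le_mul_of_nonneg_left h2 zero_le_two) (abs_nonneg t)
    have h4 := le_abs_self (t * (2 * (star u ⬝ᵥ (B *ᵥ v)).re))
    nlinarith [h3, h4]
  have hker := pof_real_kernel (a := eucNorm u) (b := eucNorm v) (c := |t| * M) hlam
    (by nlinarith [hnorm, sq_nonneg (eucNorm u)])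
  have hc2 : (|t| * M) ^ 2 / lam = M ^ 2 / lam * t ^ 2 := by rw [mul_pow, sq_abs]; ring
  have hA₁' := hA₁ u hu
  have hA₀' := hA₀ v hv
  rw [ha2] at hA₁'
  rw [hb2] at hA₀'
  have he : e * eucNorm u ^ 2 + e * eucNorm v ^ 2 = e := by rw [← mul_add, hnorm, mul_one]
  rw [hray]
  linarith [hA₁', hA₀', hsrc, hker, hc2, he]

end Abstract

/-! ### Sector bookkeeping on the torus -/

section Sector

variable {L : ℕ}

/-- `⟨u, (H − μN̂) v⟩ = 0` for `u ∈ (N', S)`, `v ∈ (2n, 0)`, `N' ≠ 2n`: `H` preserves the joint sector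
(`hamiltonian_mulVec_mem_szSector`) and `N̂ v = 2n·v`. Lieb, PRL 62 (1989) 1201. [folklore] -/
theorem pof_offDiag_eq_zero (U μ : ℝ) {N' k : ℕ} {S : ℝ} {u v : Fock (Orb (FermionTorus 2 L))}
    (hu : u ∈ szSector N' S) (hv : v ∈ szSector (Λ := FermionTorus 2 L) (2 * k) 0) (hne : N' ≠ 2 * k) :
    star u ⬝ᵥ ((hubbardTorus 2 L 1 U - (μ : ℂ) •
      (totalNumber : Matrix (Finset (Orb (FermionTorus 2 L))) (Finset (Orb (FermionTorus 2 L))) ℂ)) *ᵥ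
        v) = 0 := by
  have hHv : hubbardTorus 2 L 1 U *ᵥ v ∈ szSector (Λ := FermionTorus 2 L) (2 * k) 0 :=
    hamiltonian_mulVec_mem_szSector (fermionTorusGraph 2 L) 1 U k hv
  have hNv : IsNParticle (2 * k) v := ((mem_szSector_iff _ _ v).1 hv).1
  rw [sub_mulVec, smul_mulVec, totalNumber_mulVec_of_isNParticle hNv, dotProduct_sub, dotProduct_smul,
    dotProduct_smul, WindowInfraredBound.pgdfv_star_dotProduct_eq_zero_of_mem_szSector hu hHv hne,
    WindowInfraredBound.pgdfv_star_dotProduct_eq_zero_of_mem_szSector hu hv hne, smul_zero, smul_zero,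
    sub_zero]

/-- Sector floor of `H − μN̂`: `(E(M) − μM)‖u‖² ≤ Re⟨u, (H − μN̂) u⟩` on `(M, S)` (homogeneous
variational principle, `N̂ u = M u`). Tasaki (2020) §2.2. [folklore] -/
theorem pof_floor (U μ : ℝ) {M : ℕ} {S : ℝ} {u : Fock (Orb (FermionTorus 2 L))}
    (hu : u ∈ szSector M S) :
    ((hubbardTorus 2 L 1 U).minEnergyOn (szSector M S) - μ * (M : ℝ)) * (star u ⬝ᵥ u).re ≤
      (star u ⬝ᵥ ((hubbardTorus 2 L 1 U - (μ : ℂ) •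
        (totalNumber : Matrix (Finset (Orb (FermionTorus 2 L))) (Finset (Orb (FermionTorus 2 L))) ℂ)) *ᵥ
          u)).re := by
  rw [WindowInfraredBound.pgdfv_re_sub_smul_totalNumber _ μ hu, sub_mul]
  have h := minEnergyOn_mul_re_le (hubbardTorus 2 L 1 U) (szSector M S) hu
  linarith

/-- From the quadratic-form bound `‖Dφ‖² ≤ K L² ‖φ‖²` to norms: `‖Dφ‖ ≤ √K · L · ‖φ‖`. [folklore] -/
theorem pof_eucNorm_mulVec_le {D : Matrix (Finset (Orb (FermionTorus 2 L))) (Finset (Orb (FermionTorus 2 L))) ℂ}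
    {K : ℝ} (hK : 0 ≤ K) {φ : Fock (Orb (FermionTorus 2 L))}
    (h : (star (D *ᵥ φ) ⬝ᵥ (D *ᵥ φ)).re ≤ K * (L : ℝ) ^ 2 * (star φ ⬝ᵥ φ).re) :
    eucNorm (D *ᵥ φ) ≤ Real.sqrt K * (L : ℝ) * eucNorm φ := by
  refine (sq_le_sq₀ (eucNorm_nonneg _)
    (mul_nonneg (mul_nonneg (Real.sqrt_nonneg _) (Nat.cast_nonneg _)) (eucNorm_nonneg _))).1 ?_
  rw [eucNorm_sq, mul_pow, mul_pow, Real.sq_sqrt hK, eucNorm_sq]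
  exact h

end Sector

/-! ### C⁺_λ itself from a STATE-UNIFORM pair-amplitude bound (the only trivial "flat ⇒ C⁺_λ") -/

/-- **State-uniform pair-amplitude bound on the sector ⇒ C⁺_λ at that momentum (all `t`).** Let
`H = hubbardTorus 2 L 1 U`, `n ≥ 1`, the sector `(2n, 0)` nonzero, `m ≠ 0`, `K ≥ 0`, `c₀ > 0`. IF every
`φ ∈ (2n, 0)` has `‖Δ(m)φ‖² ≤ KL²‖φ‖²` and `‖Δ(m)ᴴφ‖² ≤ KL²‖φ‖²` (`Δ = pairFieldAt dWaveFormFactor L m`),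
THEN both one-sided own-bottom `λ_q`-regularised energy-form Gaussian-domination inequalities hold for
every real `t` with `C_χ = K/c₀` (`X = C_χL²/|q_m|²`, `λ = c₀|q_m|²`): `pof_le_minEnergyOn_sourced` with
`A = H − μ∓N̂`, `B = Δ + Δᴴ`, charged block `(2n∓2, 0)` sitting `λ` above the reference bottom
`e = E(2n) − μ∓·2n`, `M² = KL²`. The hypothesis is over ALL sector vectors (not ground states) and is
expected to fail for large `L` at fixed `K` (Dicke pair condensates); with the a-priori `K = 32L²` it
yields only `C_χ = 32L²/c₀`. Kennedy–Lieb–Shastry (1988) eqs. (17)–(19) (shape). [folklore] -/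
theorem pgdAt_of_pairAmplitudeBoundAt (L : ℕ) [NeZero L] (U : ℝ) {k : ℕ} (hk : 1 ≤ k)
    (hne : ∃ φ ∈ szSector (Λ := FermionTorus 2 L) (2 * k) 0, φ ≠ 0) {m : TorusSite 2 L} (hm : m ≠ 0)
    {K c₀ : ℝ} (hK : 0 ≤ K) (hc₀ : 0 < c₀)
    (hΔ : ∀ φ ∈ szSector (Λ := FermionTorus 2 L) (2 * k) 0,
      (star (pairFieldAt dWaveFormFactor L m *ᵥ φ) ⬝ᵥ (pairFieldAt dWaveFormFactor L m *ᵥ φ)).re ≤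
        K * (L : ℝ) ^ 2 * (star φ ⬝ᵥ φ).re)
    (hΔ' : ∀ φ ∈ szSector (Λ := FermionTorus 2 L) (2 * k) 0,
      (star ((pairFieldAt dWaveFormFactor L m)ᴴ *ᵥ φ) ⬝ᵥ ((pairFieldAt dWaveFormFactor L m)ᴴ *ᵥ φ)).re ≤
        K * (L : ℝ) ^ 2 * (star φ ⬝ᵥ φ).re) (t : ℝ) :
    ((hubbardTorus 2 L 1 U).minEnergyOn (szSector (2 * k) 0) -
        ((hubbardTorus 2 L 1 U).minEnergyOn (szSector (2 * k) 0) -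
            (hubbardTorus 2 L 1 U).minEnergyOn (szSector (2 * k - 2) 0) +
            c₀ * momentumNormSq L m) / 2 * ((2 * k : ℕ) : ℝ) -
        K / c₀ * (L : ℝ) ^ 2 / momentumNormSq L m * t ^ 2 ≤
      (hubbardTorus 2 L 1 U -
        ((((hubbardTorus 2 L 1 U).minEnergyOn (szSector (2 * k) 0) -
            (hubbardTorus 2 L 1 U).minEnergyOn (szSector (2 * k - 2) 0) +
            c₀ * momentumNormSq L m) / 2 : ℝ) : ℂ) •
          (totalNumber : Matrix (Finset (Orb (FermionTorus 2 L))) (Finset (Orb (FermionTorus 2 L))) ℂ) -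
        (t : ℂ) • (pairFieldAt dWaveFormFactor L m + (pairFieldAt dWaveFormFactor L m)ᴴ)).minEnergyOn
        (szSector (2 * k - 2) 0 ⊔ szSector (2 * k) 0)) ∧
    ((hubbardTorus 2 L 1 U).minEnergyOn (szSector (2 * k) 0) -
        ((hubbardTorus 2 L 1 U).minEnergyOn (szSector (2 * k + 2) 0) -
            (hubbardTorus 2 L 1 U).minEnergyOn (szSector (2 * k) 0) -
            c₀ * momentumNormSq L m) / 2 * ((2 * k : ℕ) : ℝ) -
        K / c₀ * (L : ℝ) ^ 2 / momentumNormSq L m * t ^ 2 ≤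
      (hubbardTorus 2 L 1 U -
        ((((hubbardTorus 2 L 1 U).minEnergyOn (szSector (2 * k + 2) 0) -
            (hubbardTorus 2 L 1 U).minEnergyOn (szSector (2 * k) 0) -
            c₀ * momentumNormSq L m) / 2 : ℝ) : ℂ) •
          (totalNumber : Matrix (Finset (Orb (FermionTorus 2 L))) (Finset (Orb (FermionTorus 2 L))) ℂ) -
        (t : ℂ) • (pairFieldAt dWaveFormFactor L m + (pairFieldAt dWaveFormFactor L m)ᴴ)).minEnergyOn
        (szSector (2 * k) 0 ⊔ szSector (2 * k + 2) 0)) := by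
  set H := hubbardTorus 2 L 1 U with hH
  set Δ := pairFieldAt dWaveFormFactor L m with hΔdef
  set Q := momentumNormSq L m with hQ
  set E := H.minEnergyOn (szSector (2 * k) 0) with hE
  set Em := H.minEnergyOn (szSector (2 * k - 2) 0) with hEm
  set Ep := H.minEnergyOn (szSector (2 * k + 2) 0) with hEp
  have hQ0 : 0 < Q := (momentumNormSq_nonneg m).lt_of_ne' fun h => hm ((momentumNormSq_eq_zero_iff m).1 h)
  have hlam : 0 < c₀ * Q := mul_pos hc₀ hQ0
  have hHerm : H.IsHermitian := LiebThm1.hamiltonian_isHermitian (fermionTorusGraph 2 L) 1 U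
  have hB : (Δ + Δᴴ).IsHermitian := isHermitian_add_transpose_self Δ
  have hM2 : (Real.sqrt K * (L : ℝ)) ^ 2 / (c₀ * Q) = K / c₀ * (L : ℝ) ^ 2 / Q := by
    rw [mul_pow, Real.sq_sqrt hK]
    field_simp
  have hcast : ((2 * k : ℕ) : ℝ) = 2 * (k : ℝ) := by push_cast; ring
  have hB₀ : ∀ v ∈ szSector (Λ := FermionTorus 2 L) (2 * k) 0, star v ⬝ᵥ ((Δ + Δᴴ) *ᵥ v) = 0 :=
    fun v hv => WindowInfraredBound.pgdfv_pairSource_diag_eq_zero dWaveFormFactor m hv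
  refine ⟨?_, ?_⟩
  · -- removal side: charged block `(2k−2, 0)`, `2μ = E − E₋ + c₀Q`
    set μ : ℝ := (E - Em + c₀ * Q) / 2 with hμ
    have h2μ : 2 * μ = E - Em + c₀ * Q := by rw [hμ]; ring
    have key := pof_le_minEnergyOn_sourced (isHermitian_sub_smul_totalNumber hHerm μ) hB
      (szSector (2 * k - 2) 0) (szSector (2 * k) 0) (e := E - μ * ((2 * k : ℕ) : ℝ)) (M := Real.sqrt K * (L : ℝ)) hlam hne
      (fun u hu v hv => WindowInfraredBound.pgdfv_star_dotProduct_eq_zero_of_mem_szSector hu hv (by omega))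
      (fun u hu v hv => pof_offDiag_eq_zero U μ hu hv (by omega))
      (fun u hu => ?_) (fun v hv => pof_floor U μ hv)
      (fun u hu => WindowInfraredBound.pgdfv_pairSource_diag_eq_zero dWaveFormFactor m hu) hB₀
      (fun u hu v hv => ?_) t
    · rwa [hM2] at key
    · -- the charged floor: `E₋ − μ(2k−2) = e + λ`
      have h := pof_floor U μ hu
      have hc' : ((2 * k - 2 : ℕ) : ℝ) = 2 * (k : ℝ) - 2 := by
        rw [Nat.cast_sub (by omega)]; push_cast; ring
      rw [hc'] at h
      rw [hcast]
      have hu0 : 0 ≤ (star u ⬝ᵥ u).re := (Complex.nonneg_iff.1 (dotProduct_star_self_nonneg u)).1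
      nlinarith [h, h2μ, hu0]
    · -- the off-diagonal source element `⟨u, (Δ + Δᴴ) v⟩ = ⟨u, Δ v⟩`, `|·| ≤ ‖u‖ √K L ‖v‖`
      have hup := WcbcsSsbToTorusLRO.conjTranspose_pairFieldAt_mulVec_mem_szSector dWaveFormFactor m hv
      rw [add_mulVec, dotProduct_add,
        WindowInfraredBound.pgdfv_star_dotProduct_eq_zero_of_mem_szSector hu hup (by omega), add_zero]
      calc ‖star u ⬝ᵥ (Δ *ᵥ v)‖ ≤ eucNorm u * eucNorm (Δ *ᵥ v) := norm_star_dotProduct_le _ _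
        _ ≤ eucNorm u * (Real.sqrt K * (L : ℝ) * eucNorm v) :=
          mul_le_mul_of_nonneg_left (pof_eucNorm_mulVec_le hK (hΔ v hv)) (eucNorm_nonneg _)
        _ = Real.sqrt K * (L : ℝ) * (eucNorm u * eucNorm v) := by ring
  · -- addition side: charged block `(2k+2, 0)`, `2μ' = E₊ − E − c₀Q`
    set μ : ℝ := (Ep - E - c₀ * Q) / 2 with hμ
    have h2μ : 2 * μ = Ep - E - c₀ * Q := by rw [hμ]; ring
    have key := pof_le_minEnergyOn_sourced (isHermitian_sub_smul_totalNumber hHerm μ) hB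
      (szSector (2 * k + 2) 0) (szSector (2 * k) 0) (e := E - μ * ((2 * k : ℕ) : ℝ)) (M := Real.sqrt K * (L : ℝ)) hlam hne
      (fun u hu v hv => WindowInfraredBound.pgdfv_star_dotProduct_eq_zero_of_mem_szSector hu hv (by omega))
      (fun u hu v hv => pof_offDiag_eq_zero U μ hu hv (by omega))
      (fun u hu => ?_) (fun v hv => pof_floor U μ hv)
      (fun u hu => WindowInfraredBound.pgdfv_pairSource_diag_eq_zero dWaveFormFactor m hu) hB₀
      (fun u hu v hv => ?_) t
    · rwa [hM2, sup_comm] at key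
    · have h := pof_floor U μ hu
      have hc' : ((2 * k + 2 : ℕ) : ℝ) = 2 * (k : ℝ) + 2 := by push_cast; ring
      rw [hc'] at h
      rw [hcast]
      have hu0 : 0 ≤ (star u ⬝ᵥ u).re := (Complex.nonneg_iff.1 (dotProduct_star_self_nonneg u)).1
      nlinarith [h, h2μ, hu0]
    · -- `⟨u, (Δ + Δᴴ) v⟩ = ⟨u, Δᴴ v⟩` for `u ∈ (2k+2, 0)`
      have hdown := WcbcsSsbToTorusLRO.pairFieldAt_mulVec_mem_szSector dWaveFormFactor m
        (by omega : 2 ≤ 2 * k) hv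
      rw [add_mulVec, dotProduct_add,
        WindowInfraredBound.pgdfv_star_dotProduct_eq_zero_of_mem_szSector hu hdown (by omega), zero_add]
      calc ‖star u ⬝ᵥ (Δᴴ *ᵥ v)‖ ≤ eucNorm u * eucNorm (Δᴴ *ᵥ v) := norm_star_dotProduct_le _ _
        _ ≤ eucNorm u * (Real.sqrt K * (L : ℝ) * eucNorm v) :=
          mul_le_mul_of_nonneg_left (pof_eucNorm_mulVec_le hK (hΔ' v hv)) (eucNorm_nonneg _)
        _ = Real.sqrt K * (L : ℝ) * (eucNorm u * eucNorm v) := by ring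

/-! ### Position bookkeeping: the state-uniform bound feeds the wave-3 C⁺_λ hypothesis verbatim -/

/-- **Off-window state-uniform pair-amplitude bound ⇒ off-window C⁺_λ** in exactly the form consumed by
`offWindowFlatAt_of_offWindowPgdAt_of_chargingFloorAt` (constants `C_χ = K`, `c₀ = 1`), at `δ ∈ (0,1/2)`
(so that `N_L ≥ 2` and the sector is nonzero, `szSector_groundState`). The hypothesis quantifies over ALL
sector vectors and is not expected to hold for large `L`; recorded only to pin the logical position
all-states-flat ⇒ C⁺_λ ⇒ (T_λ∓) ⟺_{(Ch)} (Flat). [folklore] -/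
theorem offWindowPgdAt_of_offWindowPairAmplitudeBoundAt {U δ η : ℝ} (hδ : δ ∈ Set.Ioo (0:ℝ) (1 / 2))
    (hK : ∃ K : ℝ, 0 ≤ K ∧ ∃ L₀ : ℕ, ∀ (L : ℕ) [NeZero L], L₀ ≤ L → Even L →
      ∀ m : TorusSite 2 L, η ^ 2 < momentumNormSq L m →
        ∀ φ ∈ szSector (Λ := FermionTorus 2 L) (2 * ⌊(1 - δ) * (L : ℝ) ^ 2 / 2⌋₊) 0,
          (star (pairFieldAt dWaveFormFactor L m *ᵥ φ) ⬝ᵥ (pairFieldAt dWaveFormFactor L m *ᵥ φ)).re ≤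
              K * (L : ℝ) ^ 2 * (star φ ⬝ᵥ φ).re ∧
            (star ((pairFieldAt dWaveFormFactor L m)ᴴ *ᵥ φ) ⬝ᵥ
                ((pairFieldAt dWaveFormFactor L m)ᴴ *ᵥ φ)).re ≤ K * (L : ℝ) ^ 2 * (star φ ⬝ᵥ φ).re) :
    ∃ C_χ c₀ : ℝ, 0 ≤ C_χ ∧ 0 ≤ c₀ ∧ ∃ L₀ : ℕ, ∀ (L : ℕ) [NeZero L], L₀ ≤ L → Even L →
      ∀ m : TorusSite 2 L, η ^ 2 < momentumNormSq L m → ∀ t : ℝ,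
        ((hubbardTorus 2 L 1 U).minEnergyOn (szSector (2 * ⌊(1 - δ) * (L : ℝ) ^ 2 / 2⌋₊) 0) -
            ((hubbardTorus 2 L 1 U).minEnergyOn (szSector (2 * ⌊(1 - δ) * (L : ℝ) ^ 2 / 2⌋₊) 0) -
                (hubbardTorus 2 L 1 U).minEnergyOn (szSector (2 * ⌊(1 - δ) * (L : ℝ) ^ 2 / 2⌋₊ - 2) 0) +
                c₀ * momentumNormSq L m) / 2 * ((2 * ⌊(1 - δ) * (L : ℝ) ^ 2 / 2⌋₊ : ℕ) : ℝ) -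
            C_χ * (L : ℝ) ^ 2 / momentumNormSq L m * t ^ 2 ≤
          (hubbardTorus 2 L 1 U -
            ((((hubbardTorus 2 L 1 U).minEnergyOn (szSector (2 * ⌊(1 - δ) * (L : ℝ) ^ 2 / 2⌋₊) 0) -
                (hubbardTorus 2 L 1 U).minEnergyOn (szSector (2 * ⌊(1 - δ) * (L : ℝ) ^ 2 / 2⌋₊ - 2) 0) +
                c₀ * momentumNormSq L m) / 2 : ℝ) : ℂ) •
              (totalNumber : Matrix (Finset (Orb (FermionTorus 2 L))) (Finset (Orb (FermionTorus 2 L))) ℂ) -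
            (t : ℂ) • (pairFieldAt dWaveFormFactor L m + (pairFieldAt dWaveFormFactor L m)ᴴ)).minEnergyOn
            (szSector (2 * ⌊(1 - δ) * (L : ℝ) ^ 2 / 2⌋₊ - 2) 0 ⊔
              szSector (2 * ⌊(1 - δ) * (L : ℝ) ^ 2 / 2⌋₊) 0)) ∧
        ((hubbardTorus 2 L 1 U).minEnergyOn (szSector (2 * ⌊(1 - δ) * (L : ℝ) ^ 2 / 2⌋₊) 0) -
            ((hubbardTorus 2 L 1 U).minEnergyOn (szSector (2 * ⌊(1 - δ) * (L : ℝ) ^ 2 / 2⌋₊ + 2) 0) -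
                (hubbardTorus 2 L 1 U).minEnergyOn (szSector (2 * ⌊(1 - δ) * (L : ℝ) ^ 2 / 2⌋₊) 0) -
                c₀ * momentumNormSq L m) / 2 * ((2 * ⌊(1 - δ) * (L : ℝ) ^ 2 / 2⌋₊ : ℕ) : ℝ) -
            C_χ * (L : ℝ) ^ 2 / momentumNormSq L m * t ^ 2 ≤
          (hubbardTorus 2 L 1 U -
            ((((hubbardTorus 2 L 1 U).minEnergyOn (szSector (2 * ⌊(1 - δ) * (L : ℝ) ^ 2 / 2⌋₊ + 2) 0) -
                (hubbardTorus 2 L 1 U).minEnergyOn (szSector (2 * ⌊(1 - δ) * (L : ℝ) ^ 2 / 2⌋₊) 0) -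
                c₀ * momentumNormSq L m) / 2 : ℝ) : ℂ) •
              (totalNumber : Matrix (Finset (Orb (FermionTorus 2 L))) (Finset (Orb (FermionTorus 2 L))) ℂ) -
            (t : ℂ) • (pairFieldAt dWaveFormFactor L m + (pairFieldAt dWaveFormFactor L m)ᴴ)).minEnergyOn
            (szSector (2 * ⌊(1 - δ) * (L : ℝ) ^ 2 / 2⌋₊) 0 ⊔
              szSector (2 * ⌊(1 - δ) * (L : ℝ) ^ 2 / 2⌋₊ + 2) 0)) := by
  obtain ⟨K, hK0, L₀, hK⟩ := hK
  refine ⟨K, 1, hK0, zero_le_one, max L₀ 2, fun L _ hL hev m hq t => ?_⟩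
  have hL2 : 2 ≤ L := le_of_max_le_right hL
  have hk : 1 ≤ ⌊(1 - δ) * (L : ℝ) ^ 2 / 2⌋₊ := by
    have h := wib_two_le_summitFilling hδ hL2
    omega
  have hm0 : m ≠ 0 := by
    rintro rfl
    rw [momentumNormSq_zero] at hq
    nlinarith [sq_nonneg η]
  -- the sector `(N_L, 0)` is nonzero: it has a ground state (`N_L/2 ≤ L² = |Λ|`)
  have hcard : ⌊(1 - δ) * (L : ℝ) ^ 2 / 2⌋₊ ≤ Fintype.card (FermionTorus 2 L) := by
    have hc : Fintype.card (FermionTorus 2 L) = L ^ 2 := by simp [FermionTorus, Fintype.card_lex]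
    rw [hc]
    refine Nat.floor_le_of_le ?_
    push_cast
    nlinarith [hδ.1, hδ.2, sq_nonneg (L : ℝ)]
  obtain ⟨⟨ψ, hψ⟩, -⟩ := szSector_groundState (fermionTorusGraph 2 L) 1 U hcard
  simpa only [div_one] using pgdAt_of_pairAmplitudeBoundAt L U hk ⟨ψ, hψ.1, hψ.2.1⟩ hm0 hK0 one_pos
    (fun φ hφ => (hK L (le_of_max_le_left hL) hev m hq φ hφ).1)
    (fun φ hφ => (hK L (le_of_max_le_left hL) hev m hq φ hφ).2) t

/-- **Registered one-line form** (sub-goal `pgdAtOfPairAmplitudeBoundAt` of stmt-7331, line `redirect_birth`,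
lead c11 wave 4): a state-uniform pair-amplitude bound `‖Δ(m)φ‖², ‖Δ(m)ᴴφ‖² ≤ KL²‖φ‖²` on the sector
`(2k, 0)` gives both one-sided C⁺_λ inequalities at `m ≠ 0` for all real `t`, `C_χ = K/c₀`
(`pgdAt_of_pairAmplitudeBoundAt`). [folklore] -/
theorem pgdAtOfPairAmplitudeBoundAt : ∀ (L : ℕ) [NeZero L] (U : ℝ) (k : ℕ), 1 ≤ k → (∃ φ ∈ szSector (Λ := FermionTorus 2 L) (2 * k) 0, φ ≠ 0) → ∀ m : TorusSite 2 L, m ≠ 0 → ∀ K c₀ : ℝ, 0 ≤ K → 0 < c₀ → (∀ φ ∈ szSector (Λ := FermionTorus 2 L) (2 * k) 0, (star (pairFieldAt dWaveFormFactor L m *ᵥ φ) ⬝ᵥ (pairFieldAt dWaveFormFactor L m *ᵥ φ)).re ≤ K * (L : ℝ) ^ 2 * (star φ ⬝ᵥ φ).re) → (∀ φ ∈ szSector (Λ := FermionTorus 2 L) (2 * k) 0, (star ((pairFieldAt dWaveFormFactor L m)ᴴ *ᵥ φ) ⬝ᵥ ((pairFieldAt dWaveFormFactor L m)ᴴ *ᵥ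 φ)).re ≤ K * (L : ℝ) ^ 2 * (star φ ⬝ᵥ φ).re) → ∀ t : ℝ, ((hubbardTorus 2 L 1 U).minEnergyOn (szSector (2 * k) 0) - ((hubbardTorus 2 L 1 U).minEnergyOn (szSector (2 * k) 0) - (hubbardTorus 2 L 1 U).minEnergyOn (szSector (2 * k - 2) 0) + c₀ * momentumNormSq L m) / 2 * ((2 * k : ℕ) : ℝ) - K / c₀ * (L : ℝ) ^ 2 / momentumNormSq L m * t ^ 2 ≤ (hubbardTorus 2 L 1 U - ((((hubbardTorus 2 L 1 U).minEnergyOn (szSector (2 * k) 0) - (hubbardTorus 2 L 1 U).minEnergyOn (szSector (2 * k - 2) 0) + c₀ * momentumNormSq L m) / 2 : ℝ) : ℂ) • (totalNumber : Matrix (Finset (Orb (FermionTorus 2 L))) (Finset (Orb (FermionTorus 2 L))) ℂ) - (t : ℂ) • (pairFieldAt dWaveFormFactor L m + (pairFieldAt dWaveFormFactor L m)ᴴ)).minEnergyOn (szSector (2 * k - 2) 0 ⊔ szSector (2 * k) 0)) ∧ ((hubbardTorus 2 L 1 U).minEnergyOn (szSector (2 * k) 0) - ((hubbardTorus 2 L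 1 U).minEnergyOn (szSector (2 * k + 2) 0) - (hubbardTorus 2 L 1 U).minEnergyOn (szSector (2 * k) 0) - c₀ * momentumNormSq L m) / 2 * ((2 * k : ℕ) : ℝ) - K / c₀ * (L : ℝ) ^ 2 / momentumNormSq L m * t ^ 2 ≤ (hubbardTorus 2 L 1 U - ((((hubbardTorus 2 L 1 U).minEnergyOn (szSector (2 * k + 2) 0) - (hubbardTorus 2 L 1 U).minEnergyOn (szSector (2 * k) 0) - c₀ * momentumNormSq L m) / 2 : ℝ) : ℂ) • (totalNumber : Matrix (Finset (Orb (FermionTorus 2 L))) (Finset (Orb (FermionTorus 2 L))) ℂ) - (t : ℂ) • (pairFieldAt dWaveFormFactor L m + (pairFieldAt dWaveFormFactor L m)ᴴ)).minEnergyOn (szSector (2 * k) 0 ⊔ szSector (2 * k + 2) 0)) :=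
  fun L _ U _ hk hne _ hm _ _ hK hc₀ hΔ hΔ' t => pgdAt_of_pairAmplitudeBoundAt L U hk hne hm hK hc₀ hΔ hΔ' t

end Summit.HubbardSuperconductivity.HubbardSuperconductivity.Theorems.FunctionFieldCertificate
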